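import Summits.QuantumFields.GaugeBoot.TiltedBoxLimitInvariance
import Summits.QuantumFields.GaugeBoot.ClassBRPClosure
import HarnessLib

/-!
# Infinite-volume limit points of the 45°-tilted boxes, part 8: ANTI-DIAGONAL reflection positivity

HONEST FRAMING (cell `pub-gaugeboot`, page 1 of every file): the venture produces certified bounds
on lattice expectations at stated coupling, gauge group, dimension and torus size; NOT a mass gap,
NOT a continuum limit, NOT a string tension; NOT Yang–Mills-summit-bearing (barriers
`FixedCouplingUltralocality`, `PerturbativeInvisibility`). A structural POSITIVE fact about a class
of infinite-volume Wilson states; nothing else is claimed.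

## Content

`ClassB.lean` names the three mirror families of the lattice bootstrap on `ℤ^d` (sites `x_k = 0`,
links `x_k = ½`, diagonals `x_i = x_j`); the square 45°-tilted box also carries the ANTI-DIAGONAL
mirror `x_i + x_j = 0` as a reflection of positive type (`tiltedBox_antiDiagonalRP`,
`TiltedBoxAxisFlips.lean`: the diagonal mirror conjugated by the flip of the axis `j`; on every box
`tiltedBox_antiDiagonalRP_general`, and its blocks are row blocks, `TiltedBoxAntiDiagonalWords.lean`).
Here the `ℤ^d` objects and the transfer to the tilted limit points:

* `configAntiDiagSwapZd i j := configSiteReflect j ∘ configDiagSwapZd i j ∘ configSiteReflect j` —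
  the anti-diagonal reflection of `ℤ^d` configurations (sites `(x_i, x_j) ↦ (-x_j, -x_i)`; `i`- and
  `j`-links exchanged, reversed and inverted), `antiDiagHalfEdges i j = {(x, k) : 0 ≤ x_i + x_j}` —
  the links with both endpoints in the closed half `{x_i + x_j ≥ 0}`;
* `tiltedLift_antiDiag` — the lift intertwines the box mirror `Φ_j ∘ Θ ∘ Φ_j` with
  `configAntiDiagSwapZd i j`; `isHalfObservable_antiDiag_comp_tiltedLift` — half-space cylinders
  lift to `IsHalfObservable … M (tiltedSum …)`;
* **`antiDiagRP_of_mem_tiltedBoxLimitPoints`** — for `β ≥ 0`, `i ≠ j`, every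
  `μ ∈ tiltedBoxLimitPoints d i j ρ β` is reflection positive for
  `(configAntiDiagSwapZd i j, antiDiagHalfEdges i j)`; `antiDiagBlock_nonneg_…` — the anti-diagonal
  positivity matrices are PSD; `measurePreserving_configAntiDiagSwapZd_…` — `μ` is invariant.

With parts 3–7: a tilted limit point carries `R_diag(i,j)`, `R_antidiag(i,j)`, `R_site(k)`,
`R_link(k)` (`k ∉ {i, j}`) and the Haar-shift loop equations exactly. `TiltedClassState`
(`TiltedBoxLimitClass.lean`) does not list the anti-diagonal block; this file supplies it separately.

References: J. Fröhlich, R. Israel, E. H. Lieb, B. Simon, J. Stat. Phys. 22 (1980) 297, §3;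
K. Osterwalder, E. Seiler, Ann. Phys. 110 (1978) 440, §2; V. Kazakov, Z. Zheng, arXiv:2404.16925 §3.2.
-/

noncomputable section

open MeasureTheory Filter Topology
open scoped ComplexOrder ComplexConjugate
open Literature.Probability.LatticeModels (Site)
open Literature.MathematicalPhysics.QuantumLattice

namespace Summit.QuantumFields.GaugeBoot

/-! ## The anti-diagonal mirror of `ℤ^d` configurations and its closed half -/

section Zd

variable {d : ℕ} {G : Type*}

/-- **The anti-diagonal reflection** of gauge configurations of `ℤ^d` in the hyperplane
`x_i + x_j = 0`: the diagonal swap `configDiagSwapZd i j` conjugated by the coordinate reflection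
`configSiteReflect j` (on sites `(x_i, x_j) ↦ (-x_j, -x_i)`; the `i`- and `j`-links are exchanged,
reversed and inverted, the other links carried along). [shape] A definition, asserting nothing.
[folklore] -/
def configAntiDiagSwapZd [Group G] (i j : Fin d) (U : LGConfig d G) : LGConfig d G :=
  configSiteReflect j (configDiagSwapZd i j (configSiteReflect j U))

/-- Links with both endpoints in the closed half `{x_i + x_j ≥ 0}` of the anti-diagonal mirror
(a link raises `x_i + x_j` by `0` or `1`, so the condition is on its source). [folklore] -/
def antiDiagHalfEdges (i j : Fin d) : Set (ZdEdge d) := {e | 0 ≤ e.1 i + e.1 j}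

variable [Group G] [TopologicalSpace G] [IsTopologicalGroup G] [MeasurableSpace G] [BorelSpace G]

omit [MeasurableSpace G] [BorelSpace G] in
/-- The anti-diagonal reflection is continuous. -/
theorem continuous_configAntiDiagSwapZd (i j : Fin d) :
    Continuous (configAntiDiagSwapZd (G := G) i j : LGConfig d G → LGConfig d G) :=
  (continuous_configSiteReflect j).comp
    ((continuous_configDiagSwapZd i j).comp (continuous_configSiteReflect j))

/-- The anti-diagonal reflection is measurable. -/
theorem measurable_configAntiDiagSwapZd [SecondCountableTopology G] (i j : Fin d) :
    Measurable (configAntiDiagSwapZd (G := G) i j : LGConfig d G → LGConfig d G) :=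
  (measurable_configSiteReflect j).comp
    (DiagRP.measurable_configDiagSwapZd.comp (measurable_configSiteReflect j))

omit [TopologicalSpace G] [IsTopologicalGroup G] [MeasurableSpace G] [BorelSpace G] in
/-- A cylinder observable stays a cylinder observable under the anti-diagonal reflection. -/
theorem exists_isCylinder_comp_configAntiDiagSwapZd {α : Type*} {F : LGConfig d G → α}
    {S : Finset (ZdEdge d)} (hF : IsCylinder F S) (i j : Fin d) :
    ∃ S' : Finset (ZdEdge d), IsCylinder (F ∘ configAntiDiagSwapZd i j) S' :=
  ⟨_, isCylinder_comp_configSiteReflect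
    (isCylinder_comp_configDiagSwapZd (isCylinder_comp_configSiteReflect hF j) i j) j⟩

end Zd

namespace TiltedRP

/-! ## The lift intertwines the anti-diagonal mirrors; half-space lifting -/

section Box

variable {d : ℕ} {i j : Fin d} {M L : ℕ} {G α : Type*}

/-- **The anti-diagonal mirror**: for the square box, the lift carries `Φ_j ∘ Θ ∘ Φ_j` (`Φ_j` the flip
of the axis `j`, `Θ` the diagonal mirror) to `configAntiDiagSwapZd i j`. -/
theorem tiltedLift_antiDiag [Group G] (hij : i ≠ j) (U : Config (TiltedSite d i j M M L) d G) :
    tiltedLift d i j M M L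
        (configReflect (tiltedUnit d i j M M L) j
          (tiltedFlip d M M L j (tiltedLattice_le_comap_negHom_right d L hij))
          (configSwap i j (tiltedMirror d i j M M L)
            (configReflect (tiltedUnit d i j M M L) j
              (tiltedFlip d M M L j (tiltedLattice_le_comap_negHom_right d L hij)) U))) =
      configAntiDiagSwapZd i j (tiltedLift d i j M M L U) := by
  rw [configAntiDiagSwapZd, tiltedLift_configReflect_flip, tiltedLift_configSwap,
    tiltedLift_configReflect_flip]

/-- The anti-height of the class of a site with `0 ≤ x_i + x_j < 2M`, read in `[0, 2M)`, is
`x_i + x_j`. -/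
theorem val_tiltedSum_mk [NeZero M] {x : Site d} (h0 : 0 ≤ x i + x j) (hlt : x i + x j < 2 * M) :
    ((tiltedSum d M L (x : TiltedSite d i j M M L)).val : ℤ) = x i + x j := by
  haveI : NeZero (2 * M) := ⟨by have := NeZero.ne M; omega⟩
  rw [tiltedSum_mk, ZMod.val_intCast]
  exact Int.emod_eq_of_lt h0 (by exact_mod_cast hlt)

/-- The anti-diagonal coordinate of the endpoint of a link `(x, k)` with `0 ≤ x_i + x_j ≤ m` lies in
`[0, m + 1]` (for `i ≠ j`). -/
theorem antiDiag_endpoint_bounds (hij : i ≠ j) {e : ZdEdge d} (h0 : 0 ≤ e.1 i + e.1 j) {m : ℕ}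
    (hm : e.1 i + e.1 j ≤ m) :
    0 ≤ (e.1 + Pi.single e.2 (1 : ℤ) : Site d) i + (e.1 + Pi.single e.2 (1 : ℤ) : Site d) j ∧
      (e.1 + Pi.single e.2 (1 : ℤ) : Site d) i + (e.1 + Pi.single e.2 (1 : ℤ) : Site d) j ≤ m + 1 := by
  rw [Pi.add_apply, Pi.add_apply, Pi.single_apply, Pi.single_apply]
  by_cases hi : i = e.2 <;> by_cases hj : j = e.2
  · exact absurd (hi.trans hj.symm) hij
  · rw [if_pos hi, if_neg hj]; constructor <;> omega
  · rw [if_neg hi, if_pos hj]; constructor <;> omega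
  · rw [if_neg hi, if_neg hj]; constructor <;> omega

/-- **Anti-diagonal half.** A cylinder observable supported on links `T` of the closed half
`{x_i + x_j ≥ 0}` with `x_i + x_j ≤ m` on `T`, read through the lift, is an observable of the closed
half `{0 ≤ x_i + x_j ≤ M (mod 2M)}` of every square box with `M ≥ m + 1` (`i ≠ j`). -/
theorem isHalfObservable_antiDiag_comp_tiltedLift [NeZero M] (hij : i ≠ j) {F : LGConfig d G → α}
    {T : Finset (ZdEdge d)} (hF : IsCylinder F T) (hT : ∀ e ∈ T, e ∈ antiDiagHalfEdges i j)
    {m : ℕ} (hTm : ∀ e ∈ T, e.1 i + e.1 j ≤ m) (hM : m + 1 ≤ M) :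
    IsHalfObservable (tiltedUnit d i j M M L) M (tiltedSum d M L)
      (fun U => F (tiltedLift d i j M M L U)) := by
  intro U V hUV
  refine hF fun e he => ?_
  simp only [tiltedLift_apply]
  have hmem : 0 ≤ e.1 i + e.1 j := hT e he
  have hm := hTm e he
  refine hUV _ ⟨?_, ?_⟩
  · show (tiltedSum d M L (e.1 : TiltedSite d i j M M L)).val ≤ M
    have h := val_tiltedSum_mk (L := L) (i := i) (j := j) (M := M) (x := e.1) hmem (by omega)
    omega
  · show (tiltedSum d M L ((e.1 : TiltedSite d i j M M L) + tiltedUnit d i j M M L e.2)).val ≤ M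
    rw [← mk_add_single]
    obtain ⟨h0, h1⟩ := antiDiag_endpoint_bounds hij hmem hm
    have h := val_tiltedSum_mk (L := L) (i := i) (j := j) (M := M) h0 (by omega)
    omega

variable {N : ℕ} [NeZero M] [NeZero L] [Group G] [TopologicalSpace G] [IsTopologicalGroup G]
  [CompactSpace G] [MeasurableSpace G] [BorelSpace G] [SecondCountableTopology G]
variable (ρ : G →* Matrix (Fin N) (Fin N) ℂ)

/-- **Box step**: the anti-diagonal RP pairing of the lift of a bounded measurable cylinder observable
of `{x_i + x_j ≥ 0}` with `x_i + x_j ≤ m` on its support is non-negative on every square box with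
`M ≥ m + 1`, `M ≥ 2` (`tiltedBox_antiDiagonalRP`). -/
theorem box_antiDiagRP_nonneg (hij : i ≠ j) (hM : 2 ≤ M) (hρ : Continuous ρ) {β : ℝ} (hβ : 0 ≤ β)
    {F : LGConfig d G → ℂ} {T : Finset (ZdEdge d)} (hFT : IsCylinder F T) (hFm : Measurable F)
    {C : ℝ} (hC : ∀ U, ‖F U‖ ≤ C) (hT : ∀ e ∈ T, e ∈ antiDiagHalfEdges i j) {m : ℕ}
    (hTm : ∀ e ∈ T, e.1 i + e.1 j ≤ m) (hm : m + 1 ≤ M) :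
    0 ≤ ∫ U, conj (F (configAntiDiagSwapZd i j (tiltedLift d i j M M L U))) *
      F (tiltedLift d i j M M L U) ∂(gibbs ρ (tiltedUnit d i j M M L) β) := by
  have hpos := tiltedBox_antiDiagonalRP ρ hij hM hρ hβ (fun U => F (tiltedLift d i j M M L U))
    (hFm.comp (measurable_tiltedLift d i j M M L)) ⟨C, fun U => hC _⟩
    (isHalfObservable_antiDiag_comp_tiltedLift hij hFT hT hTm hm)
  simpa only [tiltedLift_antiDiag hij] using hpos

end Box

/-! ## Anti-diagonal RP of the limit points -/

section Limit

variable {d : ℕ} {i j : Fin d} {N : ℕ}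
variable {G : Type*} [Group G] [TopologicalSpace G] [IsTopologicalGroup G] [CompactSpace G]
  [MeasurableSpace G] [BorelSpace G] [SecondCountableTopology G]
variable (ρ : G →* Matrix (Fin N) (Fin N) ℂ)

/-- **The anti-diagonal RP pairing of a tilted limit point is non-negative on continuous cylinder
observables of `{x_i + x_j ≥ 0}`.** -/
theorem integral_antiDiagSwap_nonneg_of_cylinder (hij : i ≠ j) (hρ : Continuous ρ) {β : ℝ}
    (hβ : 0 ≤ β) {μ : Measure (LGConfig d G)} (hμ : μ ∈ tiltedBoxLimitPoints d i j ρ β)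
    {F : LGConfig d G → ℂ} {T : Finset (ZdEdge d)} (hFT : IsCylinder F T) (hFc : Continuous F)
    {C : ℝ} (hC : ∀ U, ‖F U‖ ≤ C) (hFS : DependsOn F (antiDiagHalfEdges i j)) :
    0 ≤ ∫ U, conj (F (configAntiDiagSwapZd i j U)) * F U ∂μ := by
  classical
  obtain ⟨M, Q, hM, -, h⟩ := hμ
  set T' : Finset (ZdEdge d) := T.filter (· ∈ antiDiagHalfEdges (d := d) i j) with hT'
  have hFT' : IsCylinder F T' := isCylinder_filter_of_dependsOn hFT hFS
  have hTh : ∀ e ∈ T', e ∈ antiDiagHalfEdges i j := fun e he => (Finset.mem_filter.1 he).2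
  obtain ⟨m, hm⟩ : ∃ m : ℕ, ∀ e ∈ T', e.1 i + e.1 j ≤ m := by
    refine ⟨T'.sup fun e => (e.1 i + e.1 j).toNat, fun e he => ?_⟩
    have hle := Finset.le_sup (f := fun e : ZdEdge d => (e.1 i + e.1 j).toNat) he
    have : (e.1 i + e.1 j).toNat ≤ T'.sup fun e : ZdEdge d => (e.1 i + e.1 j).toNat := hle
    omega
  set H : LGConfig d G → ℂ := fun U => conj (F (configAntiDiagSwapZd i j U)) * F U with hH
  have hHc : Continuous H :=
    (Complex.continuous_conj.comp (hFc.comp (continuous_configAntiDiagSwapZd i j))).mul hFc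
  obtain ⟨T₁, hT₁⟩ := exists_isCylinder_comp_configAntiDiagSwapZd hFT i j
  have hHcyl : IsCylinder H (T₁ ∪ T) := by
    intro U V hUV
    have e1 := hT₁ fun e he => hUV e (by rw [Finset.coe_union]; exact Or.inl he)
    have e2 := hFT fun e he => hUV e (by rw [Finset.coe_union]; exact Or.inr he)
    simp only [Function.comp_apply] at e1
    simp only [hH, e1, e2]
  have hHb : ∀ U, ‖H U‖ ≤ C * C := fun U => by
    simp only [hH, norm_mul, Complex.norm_conj]
    exact mul_le_mul (hC _) (hC _) (norm_nonneg _) ((norm_nonneg (F U)).trans (hC U))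
  refine h.integral_nonneg_of_eventually hρ hHcyl hHc hHb ?_
  have hev : ∀ᶠ k in atTop, m ≤ M k := hM.eventually_ge_atTop m
  refine hev.mono fun k hk => ?_
  exact box_antiDiagRP_nonneg ρ hij (by omega) hρ hβ hFT' hFc.measurable hC hTh hm (by omega)

variable [T2Space G]

/-- **The anti-diagonal mirror preserves every tilted limit point** (composition of three
invariances of `TiltedBoxLimitInvariance.lean`). -/
theorem measurePreserving_configAntiDiagSwapZd_of_mem_tiltedBoxLimitPoints (hij : i ≠ j)
    (hρ : Continuous ρ) {β : ℝ} {μ : Measure (LGConfig d G)}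
    (hμ : μ ∈ tiltedBoxLimitPoints d i j ρ β) :
    MeasurePreserving (configAntiDiagSwapZd (G := G) i j) μ μ :=
  (reflectInvariant_of_mem_tiltedBoxLimitPoints ρ hij hρ hμ j).comp
    ((measurePreserving_configDiagSwapZd_of_mem_tiltedBoxLimitPoints ρ hij hρ hμ).comp
      (reflectInvariant_of_mem_tiltedBoxLimitPoints ρ hij hρ hμ j))

/-- **Anti-diagonal reflection positivity of every tilted limit point** (`β ≥ 0`, `i ≠ j`): all
bounded measurable observables of the closed half `{x_i + x_j ≥ 0}`. -/
theorem antiDiagRP_of_mem_tiltedBoxLimitPoints (hij : i ≠ j) (hρ : Continuous ρ) {β : ℝ}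
    (hβ : 0 ≤ β) {μ : Measure (LGConfig d G)} (hμ : μ ∈ tiltedBoxLimitPoints d i j ρ β) :
    IsReflectionPositiveFor (configAntiDiagSwapZd (G := G) i j) (antiDiagHalfEdges i j) μ := by
  haveI := isProbabilityMeasure_of_mem_tiltedBoxLimitPoints hμ
  exact IsReflectionPositiveFor.of_continuous_cylinder
    (measurePreserving_configAntiDiagSwapZd_of_mem_tiltedBoxLimitPoints ρ hij hρ hμ)
    fun F T hFT hFc ⟨C, hC⟩ hFS =>
      integral_antiDiagSwap_nonneg_of_cylinder ρ hij hρ hβ hμ hFT hFc hC hFS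

/-- **The anti-diagonal RP blocks of a tilted limit point are positive semidefinite.** -/
theorem antiDiagBlock_nonneg_of_mem_tiltedBoxLimitPoints (hij : i ≠ j) (hρ : Continuous ρ)
    {β : ℝ} (hβ : 0 ≤ β) {μ : Measure (LGConfig d G)} (hμ : μ ∈ tiltedBoxLimitPoints d i j ρ β)
    {n : ℕ} (F : Fin n → LGConfig d G → ℂ) (hF : ∀ a, Measurable (F a))
    (hFb : ∀ a, ∃ C : ℝ, ∀ U, ‖F a U‖ ≤ C) (hFS : ∀ a, DependsOn (F a) (antiDiagHalfEdges i j))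
    (c : Fin n → ℂ) :
    0 ≤ ∑ a, ∑ b, conj (c a) * c b * ∫ U, conj (F a (configAntiDiagSwapZd i j U)) * F b U ∂μ := by
  haveI := isProbabilityMeasure_of_mem_tiltedBoxLimitPoints hμ
  exact (antiDiagRP_of_mem_tiltedBoxLimitPoints ρ hij hρ hβ hμ).sum_mul_conj_nonneg
    (measurable_configAntiDiagSwapZd i j) F hF hFb hFS c

end Limit

end TiltedRP

end Summit.QuantumFields.GaugeBoot
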